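import Summits.RiemannHypothesis.RiemannHypothesis.Theses.EvenSectorBarta
import HarnessLib

/-!
# Route `EvenSectorBarta`, item `Assembly` (stmt-RiemannHypothesis-19957) — closed

`EvenBartaFloor → EvenFloorDecay → EvenOneSignedWindows → EvenNegativityOffLine → RH` is the
route's own deciding theorem `EvenSectorBarta.closes` (pure logic, by contradiction).  With
`evenBartaFloor_proof`, `evenFloorDecay_proof`, `evenNegativityOffLine_proof` (this directory) the
route reduces to its single RH-bearing crux `EvenOneSignedWindows`
(`PolarPerronFrobenius.riemannHypothesis_of_evenOneSignedWindows_routeForm`).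
-/

set_option linter.dupNamespace false

namespace Summit.RiemannHypothesis.RiemannHypothesis.Theorems.EvenSectorBarta

/-- **Item `Assembly` (stmt-RiemannHypothesis-19957)**: the four items imply RH (the route's
`closes`). [folklore] -/
theorem assembly_proof :
    Summit.RiemannHypothesis.RiemannHypothesis.Theses.EvenSectorBarta.Assembly :=
  fun h1 h2 h3 h4 => Summit.RiemannHypothesis.RiemannHypothesis.Theses.EvenSectorBarta.closes h1 h2 h3 h4

end Summit.RiemannHypothesis.RiemannHypothesis.Theorems.EvenSectorBarta
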